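import Literature.IUT.HodgeArakelov.LabelClassesOfCuspsCor24iProofs

/-!
# [IUTchII] Cor 2.4 (i): the input `h25` at the level of `Π_v`-cuspidal inertia groups (`I_t ⊆ Π_v`), PROVED reduction

S. Mochizuki, *Inter-universal Teichmüller theory II*, kurims manuscript (Dec. 2020), §2: Def 2.3 (i) p. 67,
Def 2.3 (iii) p. 68, Cor 2.4 (i) statement pp. 69–70 and proof p. 70 l. −9 – p. 71 l. 6; *Inter-universal
Teichmüller theory I*, kurims manuscript, Cor 2.5 p. 51 ([IUTchII] Cor 2.4 (i), kurims pp.69-71)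
[claim: Mochizuki2012, status: disputed] (D-0012 claim key; series DISPUTED; nothing printed is asserted here).

PROOF-ONLY companion of `LabelClassesOfCusps` (abc-iut-L6-t1, node `IUTchII:Cor2.4(i)`) and
`LabelClassesOfCuspsCor24iProofs` (abc-iut-w4-d012, `cor24_i_of_inputs`): no definitions, nothing edited.
(abc-iut cell, wave 5, seat abc-iut-w5-d132; written while auditing the B13 bridge p412701.)

WHAT IS PROVED.  In Cor 2.4 (i) the group `I_t ⊆ Π_v` is "a cuspidal inertia group [of `Π_v`] that belongs to
the class determined by `t`" (p. 69 l. −6), i.e. a cuspidal inertia group of `Π_v = Π^tp_{X̲̲_v}`; by Def 2.3 (iii)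
p. 68 "the inclusion `Π_⊆ ⊆ Π_⊇` [here `Π_v ⊆ Π^±_v`] corresponds to a totally ramified covering of curves", so
`I_t` is an index-`l` open subgroup of a cuspidal inertia group of `Π^±_v = Π^tp_{X̲_v}` — NOT itself one.  The
printed step "by [IUTchI], Corollary 2.5 [cf. also Remark 2.5.2], the inclusion `I^{γ'}_t ⊆ Π^±_{v□} ⊆ Π^±_v`
implies that `γ' ∈ Δ^±_v`" (p. 70 l. −4/−3), for `γ' ∈ Δ̂^±_v`, is hypothesis `h25` of `cor24_i_of_inputs`.
This file REDUCES `h25` — stated for the printed `I ⊆ Π_v` — to [IUTchI] Cor 2.5 APPLIED TO `X̲̲_v` (the curve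
whose tempered fundamental group IS `Π_v`, where `I_t` IS a cuspidal inertia group, so the typed
`StableCurveTemperedData.Cor25Inertia` of abc-iut-L5-t1 applies verbatim), by pure group theory inside the tower
`Π_v ⊆ Π^±_v`, `Π̂_v ⊆ Π̂^±_v ⊆ Π̂^cor_v` of Def 2.3 (i):

* `PlusMinusTower.h25_of_hatLevel` — from (h♭) "for `γ'' ∈ Δ̂_v`, `I^{γ''} ⊆ Π_v ⟹ γ'' ∈ Π_v`" (Cor 2.5 for
  `X̲̲_v`), (hsurj) "every `γ' ∈ Δ̂^±_v` is `δ·γ''` with `δ ∈ Δ^±_v`, `γ'' ∈ Δ̂_v`" (i.e. `Δ^±_v ↠ Δ̂^±_v/Δ̂_v`,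
  Def 2.3 (i) p. 67 "`Π^±_v/Π_v ⥲ Δ̂^±_v/Δ̂_v ⥲ Gal(X̲̲_v/X̲_v) (≅ ℤ/lℤ)`"), and (hinf) "`Π^±_v ∩ Π̂_v ⊆ Π_v`"
  (the covering `X̲̲_v → X̲_v` is the one cut out by `Π̂_v ⊆ Π̂^±_v`): for every `γ' ∈ Δ̂^±_v`,
  `I^{γ'} ⊆ Π^±_v ⟹ γ' ∈ Π^±_v` — LITERALLY `h25`.  PROVED.
* `PlusMinusTower.exists_mul_of_not_le` — (hsurj) itself from the tower's OWN field "`Δ̂_v` is a normal open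
  subgroup of `Δ̂^±_v` of index `l`" (`deltaHat_normal`, `deltaHat_index`), the primality of `l`
  (`S.l_prime`) and the single hypothesis "`Δ^±_v ⊄ Δ̂_v`" (the degree-`l` covering `X̲̲_v → X̲_v` is
  connected): a nontrivial subgroup of a group of prime order is everything.  PROVED.
* `PlusMinusTower.h25_of_hatLevel'` — the two combined: `h25` from (h♭) + (hinf) + "`Δ^±_v ⊄ Δ̂_v`".

Consequence for the node (typed ≠ proved; no side taken on [IUTchIII] Cor 3.12): the [IUTchI] Cor 2.5 input of
Cor 2.4 (i) should be instantiated at the `X̲̲_v`-level (`Π̂_v ≅ Π̂_{X̲̲_v}`, `Π_v ↦ Π^tp_{X̲̲_v}`,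
`Π_v`-cuspidal inertia `↦` conjugates of the `I_x`), where it matches the binder `C.IsCuspidalInertia W.piV I`
of `Cor24_i`; an instantiation at the `X̲_v`-level (`Π̂^±_v ≅ Π̂_{X̲_v}`) needs `I` cuspidal for `Π^±_v`, which
`I_t` is not (index `l`).
-/

namespace Literature.IUT.HodgeArakelov

namespace PlusMinusTower

universe u

section Conj

variable {G : Type u} [Group G]

/-- Conjugating a subgroup by one of its own elements does nothing: `δ ∈ K ⟹ K^δ = K`. [folklore] -/
private theorem map_conj_eq_self_of_mem (K : Subgroup G) {δ : G} (hδ : δ ∈ K) :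
    K.map (MulAut.conj δ).toMonoidHom = K := by
  ext y
  rw [Subgroup.mem_map_equiv, MulAut.conj_symm_apply]
  constructor
  · intro h
    have h' : δ * (δ⁻¹ * y * δ) * δ⁻¹ ∈ K := K.mul_mem (K.mul_mem hδ h) (K.inv_mem hδ)
    have e : δ * (δ⁻¹ * y * δ) * δ⁻¹ = y := by group
    rwa [e] at h'
  · intro h
    exact K.mul_mem (K.mul_mem (K.inv_mem hδ) h) hδ

/-- A conjugate `I^{γ}` of a subgroup `I ⊆ K` by an element `γ ∈ K` stays inside `K`. [folklore] -/
private theorem map_conj_le_of_le_of_mem (I K : Subgroup G) (hIK : I ≤ K) {γ : G} (hγ : γ ∈ K) :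
    I.map (MulAut.conj γ).toMonoidHom ≤ K := by
  rintro _ ⟨i, hi, rfl⟩
  exact K.mul_mem (K.mul_mem hγ (hIK hi)) (K.inv_mem hγ)

end Conj

variable {S : BadPlaceSetting.{u}} {P : TopGroup.{u}} {T : TemperedCoverings S P} (W : PlusMinusTower T)

/-- `Π_v ⊆ Π̂_v` inside `Π̂^cor_v` (Def. 2.3 (i), p. 67, the left-hand diagram included in the right-hand one;
the tower's field `embP_le_hat`). ([IUTchII] Def 2.3 (i) p.67) [claim: Mochizuki2012, status: disputed] -/
theorem piV_le_hat : W.piV ≤ W.hat := W.embP_le_hat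

/-- **IUTchII:Cor2.4(i)** — the input `h25` ("by [IUTchI], Corollary 2.5 …, the inclusion
`I^{γ'}_t ⊆ Π^±_{v□} ⊆ Π^±_v` implies that `γ' ∈ Δ^±_v`", p. 70, for `γ' ∈ Δ̂^±_v`) for a subgroup `I ⊆ Π_v`
(print: `I_t ⊆ Π_v` a cuspidal inertia group OF `Π_v`, p. 69), REDUCED to [IUTchI] Cor. 2.5 for the curve `X̲̲_v`
(`Π^tp_{X̲̲_v} = Π_v ⊆ Π̂_v = Π̂_{X̲̲_v}`), hypothesis `h25flat`, plus two facts of the tower of Def. 2.3 (i):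
`hsurj` (`Δ^±_v ↠ Δ̂^±_v/Δ̂_v`, cf. "`Π^±_v/Π_v ⥲ Δ̂^±_v/Δ̂_v`", p. 67; derivable from `Δ^±_v ⊄ Δ̂_v`, see
`exists_mul_of_not_le`) and `hinf` (`Π^±_v ∩ Π̂_v ⊆ Π_v`).  Proof: write `γ' = δ·γ''`; then
`I^{γ''} = (I^{γ'})^{δ⁻¹} ⊆ Π^±_v` and `I^{γ''} ⊆ Π̂_v`, so `I^{γ''} ⊆ Π_v`, whence `γ'' ∈ Π_v` by Cor. 2.5 for
`X̲̲_v`, and `γ' = δγ'' ∈ Π^±_v`.  PROVED for all tower data. ([IUTchII] Cor 2.4 (i) p.70)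
[claim: Mochizuki2012, status: disputed] -/
theorem h25_of_hatLevel (I : Subgroup W.Corhat) (hI : I ≤ W.piV)
    (h25flat : ∀ γ'' : W.Corhat, γ'' ∈ W.hat ⊓ W.aug.ker →
      I.map (MulAut.conj γ'').toMonoidHom ≤ W.piV → γ'' ∈ W.piV)
    (hsurj : ∀ γ' : W.Corhat, γ' ∈ W.pmHat ⊓ W.aug.ker →
      ∃ δ ∈ W.piPM ⊓ W.aug.ker, ∃ γ'' ∈ W.hat ⊓ W.aug.ker, γ' = δ * γ'')
    (hinf : W.piPM ⊓ W.hat ≤ W.piV) :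
    ∀ γ' : W.Corhat, γ' ∈ W.pmHat ⊓ W.aug.ker →
      I.map (MulAut.conj γ').toMonoidHom ≤ W.piPM → γ' ∈ W.piPM := by
  intro γ' hγ' hc
  obtain ⟨δ, hδ, γ'', hγ'', rfl⟩ := hsurj γ' hγ'
  have hδpm : δ ∈ W.piPM := (Subgroup.mem_inf.mp hδ).1
  -- `I^{γ''} = (I^{δγ''})^{δ⁻¹} ⊆ (Π^±_v)^{δ⁻¹} = Π^±_v`
  have h1 : I.map (MulAut.conj γ'').toMonoidHom ≤ W.piPM := by
    rw [← map_conj_mul_le_map_conj_iff I W.piPM δ γ'', map_conj_eq_self_of_mem W.piPM hδpm]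
    exact hc
  -- `I^{γ''} ⊆ Π̂_v` since `I ⊆ Π_v ⊆ Π̂_v` and `γ'' ∈ Π̂_v`
  have h2 : I.map (MulAut.conj γ'').toMonoidHom ≤ W.hat :=
    map_conj_le_of_le_of_mem I W.hat (hI.trans W.piV_le_hat) (Subgroup.mem_inf.mp hγ'').1
  -- hence `I^{γ''} ⊆ Π^±_v ∩ Π̂_v ⊆ Π_v`, and Cor 2.5 for `X̲̲_v` gives `γ'' ∈ Π_v`
  have h3 : I.map (MulAut.conj γ'').toMonoidHom ≤ W.piV := fun y hy => hinf (Subgroup.mem_inf.mpr ⟨h1 hy, h2 hy⟩)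
  have h4 : γ'' ∈ W.piV := h25flat γ'' hγ'' h3
  exact W.piPM.mul_mem hδpm (W.piV_le_piPM h4)

/-- **IUTchII:Def2.3(i)** — "`Δ̂_v` includes as a normal open subgroup of `Δ̂^±_v` of index `l`" (p. 67; the tower's
fields `deltaHat_normal`, `deltaHat_index`) and "`Π^±_v/Π_v ⥲ Δ̂^±_v/Δ̂_v ⥲ Gal(X̲̲_v/X̲_v) (≅ ℤ/lℤ)`" (p. 67): as
soon as `Δ^±_v ⊄ Δ̂_v` (the degree-`l` covering is nontrivial on `Δ^±_v`), EVERY element of `Δ̂^±_v` is a product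
`δ·γ''` with `δ ∈ Δ^±_v` and `γ'' ∈ Δ̂_v` — because `Δ̂^±_v/Δ̂_v` has prime order `l` (`S.l_prime`), so the image
of `Δ^±_v`, being nontrivial, is everything.  PROVED for all tower data. ([IUTchII] Def 2.3 (i) p.67)
[claim: Mochizuki2012, status: disputed] -/
theorem exists_mul_of_not_le (hnot : ¬ (W.piPM ⊓ W.aug.ker ≤ W.hat)) :
    ∀ γ' : W.Corhat, γ' ∈ W.pmHat ⊓ W.aug.ker →
      ∃ δ ∈ W.piPM ⊓ W.aug.ker, ∃ γ'' ∈ W.hat ⊓ W.aug.ker, γ' = δ * γ'' := by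
  classical
  -- an element `a ∈ Δ^±_v ∖ Δ̂_v`
  obtain ⟨a, haPM, haNot⟩ := Set.not_subset.mp hnot
  have haB : a ∈ W.pmHat ⊓ W.aug.ker :=
    Subgroup.mem_inf.mpr ⟨W.piPM_le_pmHat (Subgroup.mem_inf.mp haPM).1, (Subgroup.mem_inf.mp haPM).2⟩
  -- the quotient `Δ̂^±_v / Δ̂_v`, a group of prime order `l`
  set B : Subgroup W.Corhat := W.pmHat ⊓ W.aug.ker with hB
  set N : Subgroup B := (W.hat ⊓ W.aug.ker).subgroupOf (W.pmHat ⊓ W.aug.ker) with hN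
  haveI : N.Normal := W.deltaHat_normal
  haveI hprime : Fact (Nat.card (B ⧸ N)).Prime := by
    rw [← Subgroup.index_eq_card, hN, W.deltaHat_index]; exact ⟨S.l_prime⟩
  -- the image of `a` is nontrivial, hence generates the quotient
  have ha1 : (QuotientGroup.mk (⟨a, haB⟩ : B) : B ⧸ N) ≠ 1 := by
    intro h
    rw [QuotientGroup.eq_one_iff] at h
    exact haNot (Subgroup.mem_inf.mp (Subgroup.mem_subgroupOf.mp h)).1
  have htop := zpowers_eq_top_of_prime_card (p := Nat.card (B ⧸ N)) rfl ha1
  intro γ' hγ'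
  have hmem : (QuotientGroup.mk (⟨γ', hγ'⟩ : B) : B ⧸ N) ∈ Subgroup.zpowers (QuotientGroup.mk (⟨a, haB⟩ : B)) := by
    rw [htop]; exact Subgroup.mem_top _
  obtain ⟨k, hk⟩ := Subgroup.mem_zpowers_iff.mp hmem
  -- `γ' ≡ a^k (mod Δ̂_v)`: take `δ := a^k ∈ Δ^±_v`, `γ'' := (a^k)⁻¹ γ' ∈ Δ̂_v`
  have hk' : (QuotientGroup.mk ((⟨a, haB⟩ : B) ^ k) : B ⧸ N) = QuotientGroup.mk (⟨γ', hγ'⟩ : B) := by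
    rw [QuotientGroup.mk_zpow]; exact hk
  rw [QuotientGroup.eq] at hk'
  have hq : ((⟨a, haB⟩ : B) ^ k)⁻¹ * ⟨γ', hγ'⟩ ∈ N := hk'
  rw [hN, Subgroup.mem_subgroupOf] at hq
  refine ⟨a ^ k, Subgroup.zpow_mem _ haPM k, (a ^ k)⁻¹ * γ', ?_, ?_⟩
  · simpa using hq
  · group

/-- **IUTchII:Cor2.4(i)** — `h25` (p. 70: "`I^{γ'}_t ⊆ Π^±_v` implies `γ' ∈ Δ^±_v`", `γ' ∈ Δ̂^±_v`) for a subgroup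
`I ⊆ Π_v`, from [IUTchI] Cor. 2.5 for `X̲̲_v` (`h25flat`), `Π^±_v ∩ Π̂_v ⊆ Π_v` (`hinf`) and `Δ^±_v ⊄ Δ̂_v`
(`hnot`); the last two are properties of the covering `X̲̲_v → X̲_v` of Def. 2.3 (i) p. 67 (pull-back square /
nontriviality), to be read off the common model at the L5↔L6 merge.  PROVED for all tower data
(`h25_of_hatLevel` + `exists_mul_of_not_le`). ([IUTchII] Cor 2.4 (i) p.70) [claim: Mochizuki2012, status: disputed] -/
theorem h25_of_hatLevel' (I : Subgroup W.Corhat) (hI : I ≤ W.piV)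
    (h25flat : ∀ γ'' : W.Corhat, γ'' ∈ W.hat ⊓ W.aug.ker →
      I.map (MulAut.conj γ'').toMonoidHom ≤ W.piV → γ'' ∈ W.piV)
    (hinf : W.piPM ⊓ W.hat ≤ W.piV) (hnot : ¬ (W.piPM ⊓ W.aug.ker ≤ W.hat)) :
    ∀ γ' : W.Corhat, γ' ∈ W.pmHat ⊓ W.aug.ker →
      I.map (MulAut.conj γ').toMonoidHom ≤ W.piPM → γ' ∈ W.piPM :=
  W.h25_of_hatLevel I hI h25flat (W.exists_mul_of_not_le hnot) hinf

end PlusMinusTower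

end Literature.IUT.HodgeArakelov
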